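import Summits.BirchSwinnertonDyer.Rank1Residual.Additive.TameBranchMuPartDefectTwo
import Summits.BirchSwinnertonDyer.Rank1Residual.Additive.TameBranchKatoDivisibilityOfKato
import HarnessLib

/-!
# cc-typer-2's typed RATIONAL MAIN CONJECTURE `TameBranchRatCharEqAt W p` IS A THEOREM at every
# certified pair of X4♯(G-ord) ∩ `I₀*` ∩ {`ρ̄` onto} (`p ≥ 5`): Kato 17.4 (3) + Delbourgo 2002 (B) +
# Greenberg Prop. 3.10 + the first-unit-index certificate at `rank + 2` + the squeeze witness
# (cell `b2b-bsdres`, sub-cell additive-p2 = X3♯(G-ord)/X4♯(G-ord), gen 31; part 4 — class level)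

HONEST FRAMING (cell `b2b-bsdres`, run/shared/lean/b2b/bsd-rank1-residual/, verbatim in every
file): the goal of the cell is to DELETE the COMBINATION-SHAPED residual classes of the
Birch–Swinnerton-Dyer formula for ALL analytic-rank `≤ 1` elliptic curves over `ℚ` — "full BSD
formula for every rank `≤ 1` curve in class `C`" assembled STRICTLY from published theorems — so
that the rank-`≤ 1` remainder becomes exactly the CONSTRUCTION-SHAPED classes, which are TYPED
(missing-input `Prop`s), NOT attempted. This is not "finishing BSD". Sub-cell additive-p2: the
classes X3♯(G-ord) / X4♯(G-ord) are CONSTRUCTION-SHAPED and stay so; labels / RESIDUAL-MAP marks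
UNCHANGED; nothing is booked (the main conjecture at a pair is NOT `BSD(E,p)`: at rank 0 these rows'
`BSD(E,p)` was already closed by gen 12, at rank 1 the branch `p`-adic Gross–Zagier is still owed).
Theorems only; every published input is an explicit named-fact binder: `hK` = the semistable big-image
half-eigenspace reading of Kato 2004 Thm. 17.4 (3), `hmodD` = BCDT modular parametrisations, `hDel` =
Delbourgo 2002 (A)+(B) (A175), `hGZK` = Gross–Zagier–Kolyvagin, `hmod` = modularity (continuation of
`L(E,s)`), `h310` = Greenberg 1999 Prop. 3.10. No definition, no named fact minted, no `sorry`.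

## What and why

`TameBranchRatCharEqAt W p` (cc-typer-2, `TameBranchLower.lean`; "OPEN on every cell — its universal
closure is OUR CONJECTURE, not in print") says: for every newform `f` of `E`, every normalised tuple
`(ε, α, B)` of the E-normalised interpolation package `IsTameBranchOf f p ε α B` and every cyclotomic
dual datum, `X(E/ℚ_∞)` is torsion and **`char_Λ X(E/ℚ_∞) = (g)` with `ι g = p^k·B`**. On the defect-2
rows (`I₀*`, `E = E♭ ⊗ χ_{p*}`, `E♭` good ordinary) THIS FILE proves it at every pair carrying two
finite certificates, from refereed print:

1. gen 19's brick: `ι g₁ = C(u·ϖ)·B^±_{(p−1)/2}(f♭, α)` for some `g₁ ∈ char_Λ X` (Kato 17.4 (3) via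
   [C] + eigen-descent; `u ∈ ℤ_p^×`, `ϖ` the period ratio);
2. part 2 (`TameBranchMuPart`): the FIRST UNIT coefficient of `ϖ·B^±` at `rank + 2` gives
   `μ(char_Λ X) = 0` (theorem) and, with Delbourgo 2002 (B), Greenberg's parity and the squeeze witness
   (`2·ord_p #tors < ord_p ∏c` at rank 0; `1 + 2·ord_p #tors < v + ord_p ∏c`, `v ≤ ord_p Reg_p(E,Dh)` at
   rank 1), **`char_Λ X = (g₁)`**;
3. §1 here: gen 22's dictionary (`B_E = C(c)·B^±`, `isTameBranchOf_legendre_C_mul_padicLFunction[Minus]Branch`)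
   + gen 21's tuple rigidity (`IsTameBranchOf.tuple_eq_of_norm_eq_one`) + part 2's generator rescaling
   turn `char_Λ X = (g₁)` into the `TameBranchRatCharEqAt` conclusion for EVERY normalised tuple; the
   one extra input is that `E`'s plus modular symbol is not identically zero (`∃ s, [s]⁺_{f_E} ≠ 0`:
   automatic at rank 0 from `L(E,1) ≠ 0`; at rank 1 a one-line finite check — it excludes the
   degenerate dictionary constant `c = 0`).

§2 gives `ClassX4Gord.isTorsion_and_mu_zero_lam_le_of_katoHalf_of_firstUnit` (`μ = 0 ∧ λ ≤ n` from
Kato + the certificate at ANY index `n`, gen 19's `n = 1` generalised); the HEADLINES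
(`ClassX4Gord.tameBranchRatCharEqAt_of_katoHalf_of_firstUnit_two_rankZero` / `…_three_rankOne`) are the
sequel `TameBranchRatCharEqDefectTwoHeadlines.lean`; X3♯(G-ord) ∩ `I₀*` (Wuthrich 2014 Thm. 16) and the
full-squeeze route follow in parts 5 and 3. What is NOT claimed: `BSD(E,p)`; anything off defect 2;
`p = 3`; the certificates themselves (per pair, numerical: the census's `(μ_an, λ_an)` / `v_p(A′)`
columns). Labels UNCHANGED.

References: Kato 2004 Thm. 17.4 (3) [Kato2004Asterisque]; Delbourgo 2002 Thm. (A), (B) p. 40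
[Delbourgo2002]; Greenberg LNM 1716 Prop. 3.10, §5 p. 183 [GreenbergLNM1716]; Mazur–Tate–Teitelbaum
1986 §I.13–I.14 [MazurTateTeitelbaum1986Invent]; Delbourgo 1998 p. 151 (the conjecture) [Delbourgo1998];
`TameBranchKatoDivisibilityOfKato.lean` (gen 22), `TameBranchRigidity.lean` (gen 21),
`GordRankOneKatoCertificate{,Class}.lean` (gen 19). -/

set_option autoImplicit false

noncomputable section

open scoped Classical MatrixGroups ModularForm NumberField

open CongruenceSubgroup IsDedekindDomain WeierstrassCurve NumberField
  Literature.NumberTheory.EllipticCurves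
  Literature.NumberTheory.EllipticCurves.ModularForms
  Literature.NumberTheory.EllipticCurves.Rank1Residual
  Literature.NumberTheory.EllipticCurves.Rank1Residual.Typed
  Literature.NumberTheory.EllipticCurves.Delbourgo2002
  Literature.NumberTheory.EllipticCurves.Greenberg1999
  Literature.NumberTheory.GaloisRepresentations
  Summit.BirchSwinnertonDyer.Rank1Residual.AdditivePotMult
  Summit.BirchSwinnertonDyer.Rank1Residual.X1.MuLambda
  Summit.BirchSwinnertonDyer.Rank1Residual.X1.RankOneParitySqueeze
  Summit.BirchSwinnertonDyer.Rank1Residual.X11a.LambdaNorm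

namespace Summit.BirchSwinnertonDyer.Rank1Residual.Additive

/-! ### §1 From `char_Λ X = (g₁)`, `ι g₁ = C(v)·B^±`, to the `TameBranchRatCharEqAt` conclusion for
every normalised tuple (dictionary + rigidity + rescaling) -/

section Tuples

open TameBranchMuPart

variable {W : WeierstrassCurve ℚ} [W.IsElliptic] {p : ℕ} [hp : Fact p.Prime]

/-- `C(c)·X ≠ 0` for `c ≠ 0`, `X ≠ 0` in `ℚ_p⟦T⟧`. [folklore] -/
theorem C_mul_ne_zero {c : ℚ_[p]} (hc : c ≠ 0) {X : PowerSeries ℚ_[p]} (hX : X ≠ 0) :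
    PowerSeries.C c * X ≠ 0 := by
  intro h0
  apply hX
  have h1 : PowerSeries.C c⁻¹ * (PowerSeries.C c * X) = 0 := by rw [h0, mul_zero]
  rwa [← mul_assoc, ← map_mul, inv_mul_cancel₀ hc, map_one, one_mul] at h1

/-- Norms of the coefficients of `C(u·ϖ)·B` and of `C(ϖ)·B` agree for `u ∈ ℤ_p^×`. [folklore] -/
theorem norm_coeff_C_unit_mul (u : ℤ_[p]ˣ) (ϖ : ℚ_[p]) (B : PowerSeries ℚ_[p]) (j : ℕ) :
    ‖PowerSeries.coeff j (PowerSeries.C (((u : ℤ_[p]) : ℚ_[p]) * ϖ) * B)‖ =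
      ‖PowerSeries.coeff j (PowerSeries.C ϖ * B)‖ := by
  have hu : ‖((u : ℤ_[p]) : ℚ_[p])‖ = 1 := by
    rw [← PadicInt.norm_def]; exact PadicInt.isUnit_iff.mp u.isUnit
  rw [PowerSeries.coeff_C_mul, PowerSeries.coeff_C_mul, mul_assoc, norm_mul, hu, one_mul]

/-- **Core, even branch (`p ≡ 1 (mod 4)`).** `E = W` additive at `p`, `V = E♭` globally minimal good
ordinary with `C • V^{(p)} = W`, `f`/`g` the newforms of `W`/`V`, `E`'s plus symbol not identically
zero, and an ideal `I = (g₁)` with `ι g₁ = C(v)·B⁺_{(p−1)/2}(g, α_p(V))`, `v ≠ 0`, `B⁺ ≠ 0`. Then for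
EVERY tuple `(ε, α, B)` of the package with `‖α‖ = 1`: **`I = (g')` with `ι g' = p^k·B`, `k ∈ ℤ`** —
the dictionary tuple `(χ_p, α_p(V), C(c)·B⁺)` has `c ≠ 0` (else every `[s]⁺_f` vanishes), rigidity
identifies the given tuple with it, and the generator is rescaled by the unit part of `c/v`.
[cite: MazurTateTeitelbaum1986Invent, §I.13–I.14 (14.3)] -/
theorem exists_span_eq_and_iota_eq_of_isTameBranchOf_of_iota_eq_branch (hp4 : p % 4 = 1)
    (V : WeierstrassCurve ℚ) [V.IsElliptic] [V.IsGloballyMinimal]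
    (hVW : ∃ C : VariableChange ℚ, C • V.quadraticTwist (p : ℚ) = W) (hadd : Addv W p)
    (hord : GoodOrd V p) {N N' : ℕ} [NeZero N] [NeZero N'] {f : CuspForm (Gamma0 N) 2}
    {g : CuspForm (Gamma0 N') 2} (hf : IsNewformOf W f) (hg : IsNewformOf V g)
    (hnd : ∃ s : ℚ, ratPlusSymbol f s ≠ 0)
    {I : Ideal (IwasawaAlgebra p)} {g₁ : IwasawaAlgebra p} (hI : I = Ideal.span {g₁})
    {v : ℚ_[p]} (hv : v ≠ 0)
    (hι : iwasawaToPowerSeries p g₁ =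
      PowerSeries.C v * padicLFunctionBranch g (unitRoot V p : ℚ_[p]) (p / 2))
    (hB0 : padicLFunctionBranch g (unitRoot V p : ℚ_[p]) (p / 2) ≠ 0)
    {ε : DirichletCharacter ℂ_[p] p} {α : ℚ_[p]} {B : PowerSeries ℚ_[p]} (hα : ‖α‖ = 1)
    (hB : IsTameBranchOf f p ε α B) :
    ∃ (g' : IwasawaAlgebra p) (k : ℤ), I = Ideal.span {g'} ∧
      iwasawaToPowerSeries p g' = PowerSeries.C ((p : ℚ_[p]) ^ k) * B := by
  have hp2 : p ≠ 2 := (ne_two_and_legendreSym_neg_one_of_mod_four_eq_one (p := p) hp4).1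
  have hordV : IsOrdinaryAt V p := (isOrdinaryAt_iff V p).mpr hord
  obtain ⟨c, hrel⟩ := exists_legendreTwistPlusRel_of_twist hp4 V W hVW hadd hf hg
  have hdict := isTameBranchOf_legendre_C_mul_padicLFunctionBranch V hp2 hordV hg hrel
  -- `c ≠ 0`: otherwise every plus symbol of `f` vanishes
  have hc : (c : ℚ_[p]) ≠ 0 := by
    obtain ⟨s, hs⟩ := hnd
    have hc' : c ≠ 0 := by
      rintro rfl
      exact hs (by rw [hrel s, zero_mul])
    exact_mod_cast hc'
  have hd0 := C_mul_ne_zero hc hB0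
  obtain ⟨-, -, hBeq⟩ := hdict.tuple_eq_of_norm_eq_one hp2 hB hd0 hα
  obtain ⟨g', k, hspan, hι'⟩ := exists_span_eq_and_iota_eq_C_zpow_mul hv hc hι
  exact ⟨g', k, by rw [hI, hspan], by rw [hι', hBeq]⟩

/-- **Core, odd branch (`p ≡ 3 (mod 4)`)**: the same with `C • V^{(−p)} = W` and the MINUS branch
`B⁻_{(p−1)/2}(g, α_p(V))` (`isTameBranchOf_legendre_C_mul_padicLFunctionMinusBranch`,
`exists_legendreTwistMinusRel_of_twist`). [cite: MazurTateTeitelbaum1986Invent, §I.13–I.14 (14.3)] -/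
theorem exists_span_eq_and_iota_eq_of_isTameBranchOf_of_iota_eq_minusBranch (hp4 : p % 4 = 3)
    (V : WeierstrassCurve ℚ) [V.IsElliptic] [V.IsGloballyMinimal]
    (hVW : ∃ C : VariableChange ℚ, C • V.quadraticTwist (-(p : ℚ)) = W) (hadd : Addv W p)
    (hord : GoodOrd V p) {N N' : ℕ} [NeZero N] [NeZero N'] {f : CuspForm (Gamma0 N) 2}
    {g : CuspForm (Gamma0 N') 2} (hf : IsNewformOf W f) (hg : IsNewformOf V g)
    (hnd : ∃ s : ℚ, ratPlusSymbol f s ≠ 0)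
    {I : Ideal (IwasawaAlgebra p)} {g₁ : IwasawaAlgebra p} (hI : I = Ideal.span {g₁})
    {v : ℚ_[p]} (hv : v ≠ 0)
    (hι : iwasawaToPowerSeries p g₁ =
      PowerSeries.C v * padicLFunctionMinusBranch g (unitRoot V p : ℚ_[p]) (p / 2))
    (hB0 : padicLFunctionMinusBranch g (unitRoot V p : ℚ_[p]) (p / 2) ≠ 0)
    {ε : DirichletCharacter ℂ_[p] p} {α : ℚ_[p]} {B : PowerSeries ℚ_[p]} (hα : ‖α‖ = 1)
    (hB : IsTameBranchOf f p ε α B) :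
    ∃ (g' : IwasawaAlgebra p) (k : ℤ), I = Ideal.span {g'} ∧
      iwasawaToPowerSeries p g' = PowerSeries.C ((p : ℚ_[p]) ^ k) * B := by
  have hp2 : p ≠ 2 := (ne_two_and_legendreSym_neg_one_of_mod_four_eq_three (p := p) hp4).1
  have hordV : IsOrdinaryAt V p := (isOrdinaryAt_iff V p).mpr hord
  obtain ⟨c, hrel⟩ := exists_legendreTwistMinusRel_of_twist hp4 V W hVW hadd hf hg
  have hdict := isTameBranchOf_legendre_C_mul_padicLFunctionMinusBranch V hp2 hordV hg hrel
  have hc : (c : ℚ_[p]) ≠ 0 := by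
    obtain ⟨s, hs⟩ := hnd
    have hc' : c ≠ 0 := by
      rintro rfl
      exact hs (by rw [hrel s, zero_mul])
    exact_mod_cast hc'
  have hd0 := C_mul_ne_zero hc hB0
  obtain ⟨-, -, hBeq⟩ := hdict.tuple_eq_of_norm_eq_one hp2 hB hd0 hα
  obtain ⟨g', k, hspan, hι'⟩ := exists_span_eq_and_iota_eq_C_zpow_mul hv hc hι
  exact ⟨g', k, by rw [hI, hspan], by rw [hι', hBeq]⟩

/-- **Both parities glued.** `W` additive at the odd prime `p`, `V` globally minimal good ordinary with
`C • V^{(p*)} = W`, `f` a newform of `W` with a non-zero plus symbol, `Dm` parametrisation data of `V`,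
`ϖ` the period ratio of the parity of `(p−1)/2`, `D` a cyclotomic dual datum whose characteristic ideal
IS GENERATED by an element `g₁` with `ι g₁ = C(u·ϖ)·B^±_{(p−1)/2}(Dm.f, α_p(V))` (`u ∈ ℤ_p^×`), the
branch being non-zero. Then for every normalised tuple `(ε, α, B)`:
`char_Λ X = (g')`, `ι g' = p^k·B` — the conclusion of `TameBranchRatCharEqAt` at `(f, ε, α, B, D)`.
[cite: MazurTateTeitelbaum1986Invent, §I.13–I.14 (14.3)] -/
theorem exists_charIdeal_eq_span_and_iota_eq_of_generator (hp2 : p ≠ 2)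
    (V : WeierstrassCurve ℚ) [V.IsElliptic] [V.IsGloballyMinimal] (C : VariableChange ℚ)
    (hC : C • V.quadraticTwist ((-1 : ℚ) ^ (p / 2) * p) = W) (hadd : Addv W p) (hord : GoodOrd V p)
    {N N' : ℕ} [NeZero N] [NeZero N'] {f : CuspForm (Gamma0 N) 2} (hf : IsNewformOf W f)
    (hnd : ∃ s : ℚ, ratPlusSymbol f s ≠ 0) (Dm : ModularParametrizationData V N')
    {ϖ : ℚ} (hϖ0 : ϖ ≠ 0)
    {κ : ZpExtension ℚ p} {γ : Field.absoluteGaloisGroup ℚ} {D : W.SelmerDualData κ γ}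
    {g₁ : IwasawaAlgebra p} (hchar : D.charIdeal = Ideal.span {g₁}) {u : ℤ_[p]ˣ}
    (hι : iwasawaToPowerSeries p g₁ =
      PowerSeries.C (((u : ℤ_[p]) : ℚ_[p]) * (ϖ : ℚ_[p])) *
        (if Even (p / 2) then padicLFunctionBranch Dm.f ((unitRoot V p : ℤ_[p]) : ℚ_[p]) (p / 2)
          else padicLFunctionMinusBranch Dm.f ((unitRoot V p : ℤ_[p]) : ℚ_[p]) (p / 2)))
    (hB0 : (if Even (p / 2) then padicLFunctionBranch Dm.f ((unitRoot V p : ℤ_[p]) : ℚ_[p]) (p / 2)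
      else padicLFunctionMinusBranch Dm.f ((unitRoot V p : ℤ_[p]) : ℚ_[p]) (p / 2)) ≠ 0)
    {ε : DirichletCharacter ℂ_[p] p} {α : ℚ_[p]} {B : PowerSeries ℚ_[p]} (hα : ‖α‖ = 1)
    (hB : IsTameBranchOf f p ε α B) :
    ∃ (g' : IwasawaAlgebra p) (k : ℤ), D.charIdeal = Ideal.span {g'} ∧
      iwasawaToPowerSeries p g' = PowerSeries.C ((p : ℚ_[p]) ^ k) * B := by
  have hv : (((u : ℤ_[p]) : ℚ_[p]) * (ϖ : ℚ_[p])) ≠ 0 :=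
    mul_ne_zero (PadicInt.coe_ne_zero.mpr u.ne_zero) (by exact_mod_cast hϖ0)
  have hodd : p % 4 = 1 ∨ p % 4 = 3 := by
    obtain ⟨k, hk⟩ := hp.out.odd_of_ne_two hp2
    omega
  rcases hodd with h1 | h3
  · have heven : Even (p / 2) := ⟨p / 4, by omega⟩
    rw [if_pos heven] at hι hB0
    have hC' : C • V.quadraticTwist (p : ℚ) = W := by
      rw [pStar_eq_of_mod_four p (Or.inl h1), if_pos h1] at hC
      exact hC
    exact exists_span_eq_and_iota_eq_of_isTameBranchOf_of_iota_eq_branch h1 V ⟨C, hC'⟩ hadd hord hf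
      Dm.isNewformOf hnd hchar hv hι hB0 hα hB
  · have hnot : ¬ Even (p / 2) := by rw [Nat.not_even_iff_odd]; exact ⟨p / 4, by omega⟩
    rw [if_neg hnot] at hι hB0
    have hC' : C • V.quadraticTwist (-(p : ℚ)) = W := by
      rw [pStar_eq_of_mod_four p (Or.inr h3), if_neg (by omega)] at hC
      exact hC
    exact exists_span_eq_and_iota_eq_of_isTameBranchOf_of_iota_eq_minusBranch h3 V ⟨C, hC'⟩ hadd hord
      hf Dm.isNewformOf hnd hchar hv hι hB0 hα hB

end Tuples

/-! ### §2 X4♯(G-ord) ∩ `I₀*` ∩ {`ρ̄` onto}, `p ≥ 5`: Kato + the first-unit-index certificate ⟹ `μ = 0`, `λ ≤ n` -/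

section ClassLevel

open TameBranchMuPart

variable {W : WeierstrassCurve ℚ} [W.IsElliptic] [W.IsGloballyMinimal] {p : ℕ} [hp : Fact p.Prime]

/-- **`μ = 0` AND `λ ≤ n` FROM KATO + THE FIRST-UNIT-INDEX CERTIFICATE (X4♯(G-ord) ∩ `I₀*` ∩ {`ρ̄`
onto}, `p ≥ 5`).** If for every good-ordinary twist model `V` (`C • V^{(p*)} = W`), every newform `f` of
`V` and every period ratio `ϖ` of the parity of `(p−1)/2` the Néron-normalised branch `ϖ·B^±_{(p−1)/2}(f,
α_p(V))` has its FIRST UNIT coefficient at `n` (`‖[Tⁿ]‖ = 1`, `‖[Tⁱ]‖ < 1` for `i < n`; the census's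
`(μ_an, λ_an) = (0, n)`), then for every cyclotomic dual datum and every generator `fE` of
`char_Λ X(E/ℚ_∞)`: `X` is torsion, **`μ(fE) = 0`** and **`λ(fE) ≤ n`** — gen 19's one-number certificate
(`n = 1`) at EVERY index. [cite: Kato2004Asterisque, Thm. 17.4 (3) (p. 273)] [cite: Washington1997, §7.1] -/
theorem ClassX4Gord.isTorsion_and_mu_zero_lam_le_of_katoHalf_of_firstUnit
    (hK : Wuthrich2014.kato_halfEigenCharIdeal_dvd_cyclotomicPrime_of_surjective)
    (hmodD : nonempty_modularParametrizationData)
    (hX : ClassX4Gord W p) (hp5 : 5 ≤ p) (he : semistabilityIndex W p = 2) (hsurj : Surj W p) {n : ℕ}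
    (hcert : ∀ (V : WeierstrassCurve ℚ) [V.IsElliptic] [V.IsGloballyMinimal] (C : VariableChange ℚ),
      C • V.quadraticTwist ((-1 : ℚ) ^ (p / 2) * p) = W → IsOrdinaryAt V p →
      ∀ {N : ℕ} [NeZero N] (f : CuspForm (Gamma0 N) 2), IsNewformOf V f →
      ∀ ϖ : ℚ, (if Even (p / 2) then (ϖ : ℝ) * V.realPeriodRat = plusPeriod f
          else (ϖ : ℝ) * V.imaginaryPeriodRat = minusPeriod f) →
        ‖PowerSeries.coeff n (PowerSeries.C (ϖ : ℚ_[p]) *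
            (if Even (p / 2) then padicLFunctionBranch f ((unitRoot V p : ℤ_[p]) : ℚ_[p]) (p / 2)
              else padicLFunctionMinusBranch f ((unitRoot V p : ℤ_[p]) : ℚ_[p]) (p / 2)))‖ = 1 ∧
        ∀ i < n, ‖PowerSeries.coeff i (PowerSeries.C (ϖ : ℚ_[p]) *
            (if Even (p / 2) then padicLFunctionBranch f ((unitRoot V p : ℤ_[p]) : ℚ_[p]) (p / 2)
              else padicLFunctionMinusBranch f ((unitRoot V p : ℤ_[p]) : ℚ_[p]) (p / 2)))‖ < 1)
    {κ : ZpExtension ℚ p} {γ : Field.absoluteGaloisGroup ℚ}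
    (hκ : κ.IsCyclotomic) (hγ : κ.IsTopGenerator γ) (hγ' : IsCyclotomicVariable p γ)
    (D : W.SelmerDualData κ γ) {fE : IwasawaAlgebra p} (hchar : D.charIdeal = Ideal.span {fE}) :
    D.IsTorsion ∧ mu fE = 0 ∧ lam fE ≤ n := by
  have hp2 : p ≠ 2 := by omega
  obtain ⟨V, iV, iVm, C, hV, hC⟩ := hX.exists_goodOrd_pStar_twist_model W p he
  haveI : NeZero (V.conductorNorm ℤ) := ⟨(V.conductorNorm_pos_holds).ne'⟩
  obtain ⟨Dm⟩ := hmodD V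
  obtain ⟨ϖ, hϖ⟩ := exists_periodRatio_parity (p := p) V Dm
  have hj := padicValRat_j_nonneg_of_typeGOrd W p hX.typeGOrd
  have hsurjV : ∀ m : ℕ, V.HasSurjectiveModNGaloisRep (p ^ m : ℕ) :=
    X4RankZeroTwistOdd.forall_surj_pow_twist_of_surj W p hp5 V (pStar_ne_zero p) C hC hsurj
  have hord : IsOrdinaryAt V p :=
    isOrdinaryAt_of_goodOrd_or_mult_of_model_twist W V (pStar_ne_zero p) ⟨C, hC⟩ hj (Or.inl hV)
  obtain ⟨hXt, g, hg, u, hι⟩ := isTorsion_and_exists_iota_eq_branch_of_katoComponent W p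
    (Kato2004.charIdeal_dvd_padicLFunctionBranch_component_of_surjective_of_half hK) hj hp2 V
    ⟨C, hC⟩ (Or.inl hV) hsurjV hκ hγ hγ' Dm.isNewformOf D ϖ hϖ
  obtain ⟨hn, hlt⟩ := hcert V C hC hord Dm.f Dm.isNewformOf ϖ hϖ
  have hdvd : fE ∣ g := by rw [hchar] at hg; exact Ideal.mem_span_singleton.mp hg
  rw [← norm_coeff_C_unit_mul u] at hn
  obtain ⟨-, hμ, hlam⟩ := mu_eq_zero_and_lam_le_of_dvd_of_firstUnit hdvd hι hn
    (fun i hi ↦ by rw [norm_coeff_C_unit_mul u]; exact hlt i hi)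
  exact ⟨hXt, hμ, hlam⟩

end ClassLevel

end Summit.BirchSwinnertonDyer.Rank1Residual.Additive

end
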